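import Mathlib
import HarnessLib
import Summits.ResolutionOfSingularities.ResolutionOfSingularities.Theorems.HomologicalConductorPersistenceKC3JacobianFloorBasis
import Summits.ResolutionOfSingularities.ResolutionOfSingularities.Theorems.HomologicalConductorPersistenceKC3XbGens

/-!
# K-SD0 branch (ii) SD-K1 — the deformed normalisations `A_u = k[a⁶ + u·abc, b³, c²]`, III: the MULTIPLICATION
# TABLE of the box basis of `W₀ = k[a,b,c]^{μ₆(1,2,3)}` over `A_u` (chain W4.4b, seat res-L1-w44b-stub-4 gen 5;
# kernel half of «b³c² ∈ ca⁴(T₁)», CHAIN v13.13 §V13.21.8)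

[OURS · L1 w44b · K-SD0 stmt-16485 / rung S-2] Nothing here is a statement of the manuscript under review
(Hironaka 2017); AI-written, weaker than expert review.

Continues `…KC3JacobianFloorDefs/Basis.lean`.  With `T₀ = θ_u(A) = a⁶ + u·abc`, `T₁ = b³`, `T₂ = c²`, `U = u`
(all in `A_u`) and the box basis `m₀,…,m₅ = 1, a⁴b, a²b², a³c, abc, a⁵b²c` of `W₀` over `A_u`
(`kc3BasisAu`), the structure constants of `W₀` as an `A_u`-ALGEBRA:
`mₙ · mᵢ = Σₗ cₗ • mₗ` (`m{n}_mul_m{i}`, `1 ≤ n ≤ 4`, all `i`; at most two terms each, e.g.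
`a⁴b · a⁴b = T₀ • a²b² − U T₁ • a³c`, `abc · a⁵b²c = T₀T₁T₂ • 1 − U T₁T₂ • abc`) — each a polynomial identity in
`k[a,b,c]` closed by `ring` — and `adjoin_box_eq_top`: `W₀ = A_u[a⁴b, a²b², a³c, abc]`.  These feed the
centrality computation of the sibling file `…KC3JacobianFloor.lean` (the different floor `b³c² ∈ ca⁴(W₀)`).
-/

noncomputable section

-- single-problem summit: the doubled namespace component `ResolutionOfSingularities` is forced
set_option linter.dupNamespace false

open MvPolynomial

universe u

namespace Summit.ResolutionOfSingularities.ResolutionOfSingularities.Theorems.HomologicalConductor.KC3JacobianFloor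

open Summit.ResolutionOfSingularities.ResolutionOfSingularities.Theorems.HomologicalConductor.KC3Witness
  (e e_apply_zero e_apply_one e_apply_two e_add e_zero e_le_iff e_sub)
open Summit.ResolutionOfSingularities.ResolutionOfSingularities.Theorems.HomologicalConductor.KC3FrobeniusOrder
open Summit.ResolutionOfSingularities.ResolutionOfSingularities.Theorems.HomologicalConductor.KC3XbLattice (monomial_e)

variable {k : Type u} [Field k] (u : k)

/-! ## The multiplication table of the box monomials over `A_u` -/

/-- `box 0 = (0,0,0)`. [OURS · bookkeeping] -/ theorem box_zero : box 0 = e 0 0 0 := rfl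
/-- `box 1 = (4,1,0)`. [OURS · bookkeeping] -/ theorem box_one : box 1 = e 4 1 0 := rfl
/-- `box 2 = (2,2,0)`. [OURS · bookkeeping] -/ theorem box_two : box 2 = e 2 2 0 := rfl
/-- `box 3 = (3,0,1)`. [OURS · bookkeeping] -/ theorem box_three : box 3 = e 3 0 1 := rfl
/-- `box 4 = (1,1,1)`. [OURS · bookkeeping] -/ theorem box_four : box 4 = e 1 1 1 := rfl
/-- `box 5 = (5,2,1)`. [OURS · bookkeeping] -/ theorem box_five : box 5 = e 5 2 1 := rfl

/-- `m₀ = 1`. [OURS · bookkeeping] -/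
theorem boxMonomial_zero : boxMonomial k 0 = 1 := Subtype.ext (by rw [coe_boxMonomial, box_zero, e_zero]; rfl)

/-- The scalar `u ∈ k ⊆ A_u` as a polynomial. [OURS · bookkeeping] -/
theorem coe_algebraMap_k (c : k) : ((algebraMap k ↥(kc3Au u) c : ↥(kc3Au u)) : MvPolynomial (Fin 3) k) = C c :=
  rfl

section Table

/-! The fourteen products `mₙ · mᵢ` (`1 ≤ n ≤ 4`, `n ≤ i ≤ 5`) in the `A_u`-basis; notation in the docstrings:
`T₀ = θ_u(A) = a⁶ + u·abc`, `T₁ = b³`, `T₂ = c²`, `U = u`. All are polynomial identities in `k[a,b,c]`. -/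

/-- `a⁴b · a⁴b = T₀ • a²b² − U T₁ • a³c`. [OURS · bookkeeping] -/
theorem m1_mul_m1 : boxMonomial k 1 * boxMonomial k 1 =
    (θuA u (X 0)) • boxMonomial k 2 - (algebraMap k _ u * θuA u (X 1)) • boxMonomial k 3 := by
  apply Subtype.ext
  simp only [Subalgebra.coe_mul, Subalgebra.coe_sub, coe_smul_kc3Au, coe_θuA, θu_X_zero, θu_X_one, coe_algebraMap_k, coe_boxMonomial, box_one, box_three, box_two, monomial_e, map_one]
  ring

/-- `a⁴b · a²b² = T₀ T₁ • 1 − U T₁ • abc`. [OURS · bookkeeping] -/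
theorem m1_mul_m2 : boxMonomial k 1 * boxMonomial k 2 =
    (θuA u (X 0) * θuA u (X 1)) • boxMonomial k 0 - (algebraMap k _ u * θuA u (X 1)) • boxMonomial k 4 := by
  apply Subtype.ext
  simp only [Subalgebra.coe_mul, Subalgebra.coe_sub, coe_smul_kc3Au, coe_θuA, θu_X_zero, θu_X_one, coe_algebraMap_k, coe_boxMonomial, box_four, box_one, box_two, box_zero, monomial_e, map_one]
  ring

/-- `a⁴b · a³c = T₀ • abc − U T₂ • a²b²`. [OURS · bookkeeping] -/
theorem m1_mul_m3 : boxMonomial k 1 * boxMonomial k 3 =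
    (θuA u (X 0)) • boxMonomial k 4 - (algebraMap k _ u * θuA u (X 2)) • boxMonomial k 2 := by
  apply Subtype.ext
  simp only [Subalgebra.coe_mul, Subalgebra.coe_sub, coe_smul_kc3Au, coe_θuA, θu_X_zero, θu_X_two, coe_algebraMap_k, coe_boxMonomial, box_four, box_one, box_three, box_two, monomial_e, map_one]
  ring

/-- `a⁴b · abc = a⁵b²c`. [OURS · bookkeeping] -/
theorem m1_mul_m4 : boxMonomial k 1 * boxMonomial k 4 =
    boxMonomial k 5 := by
  apply Subtype.ext
  simp only [Subalgebra.coe_mul, coe_boxMonomial, box_five, box_four, box_one, monomial_e, map_one]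
  ring

/-- `a⁴b · a⁵b²c = T₀ T₁ • a³c − U T₁ T₂ • a⁴b`. [OURS · bookkeeping] -/
theorem m1_mul_m5 : boxMonomial k 1 * boxMonomial k 5 =
    (θuA u (X 0) * θuA u (X 1)) • boxMonomial k 3 - (algebraMap k _ u * θuA u (X 1) * θuA u (X 2)) • boxMonomial k 1 := by
  apply Subtype.ext
  simp only [Subalgebra.coe_mul, Subalgebra.coe_sub, coe_smul_kc3Au, coe_θuA, θu_X_zero, θu_X_one, θu_X_two, coe_algebraMap_k, coe_boxMonomial, box_five, box_one, box_three, monomial_e, map_one]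
  ring

/-- `a²b² · a²b² = T₁ • a⁴b`. [OURS · bookkeeping] -/
theorem m2_mul_m2 : boxMonomial k 2 * boxMonomial k 2 =
    (θuA u (X 1)) • boxMonomial k 1 := by
  apply Subtype.ext
  simp only [Subalgebra.coe_mul, coe_smul_kc3Au, coe_θuA, θu_X_one, coe_boxMonomial, box_one, box_two, monomial_e, map_one]
  ring

/-- `a²b² · a³c = a⁵b²c`. [OURS · bookkeeping] -/
theorem m2_mul_m3 : boxMonomial k 2 * boxMonomial k 3 =
    boxMonomial k 5 := by
  apply Subtype.ext
  simp only [Subalgebra.coe_mul, coe_boxMonomial, box_five, box_three, box_two, monomial_e, map_one]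
  ring

/-- `a²b² · abc = T₁ • a³c`. [OURS · bookkeeping] -/
theorem m2_mul_m4 : boxMonomial k 2 * boxMonomial k 4 =
    (θuA u (X 1)) • boxMonomial k 3 := by
  apply Subtype.ext
  simp only [Subalgebra.coe_mul, coe_smul_kc3Au, coe_θuA, θu_X_one, coe_boxMonomial, box_four, box_three, box_two, monomial_e, map_one]
  ring

/-- `a²b² · a⁵b²c = T₀ T₁ • abc − U T₁ T₂ • a²b²`. [OURS · bookkeeping] -/
theorem m2_mul_m5 : boxMonomial k 2 * boxMonomial k 5 =
    (θuA u (X 0) * θuA u (X 1)) • boxMonomial k 4 - (algebraMap k _ u * θuA u (X 1) * θuA u (X 2)) • boxMonomial k 2 := by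
  apply Subtype.ext
  simp only [Subalgebra.coe_mul, Subalgebra.coe_sub, coe_smul_kc3Au, coe_θuA, θu_X_zero, θu_X_one, θu_X_two, coe_algebraMap_k, coe_boxMonomial, box_five, box_four, box_two, monomial_e, map_one]
  ring

/-- `a³c · a³c = T₀ T₂ • 1 − U T₂ • abc`. [OURS · bookkeeping] -/
theorem m3_mul_m3 : boxMonomial k 3 * boxMonomial k 3 =
    (θuA u (X 0) * θuA u (X 2)) • boxMonomial k 0 - (algebraMap k _ u * θuA u (X 2)) • boxMonomial k 4 := by
  apply Subtype.ext
  simp only [Subalgebra.coe_mul, Subalgebra.coe_sub, coe_smul_kc3Au, coe_θuA, θu_X_zero, θu_X_two, coe_algebraMap_k, coe_boxMonomial, box_four, box_three, box_zero, monomial_e, map_one]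
  ring

/-- `a³c · abc = T₂ • a⁴b`. [OURS · bookkeeping] -/
theorem m3_mul_m4 : boxMonomial k 3 * boxMonomial k 4 =
    (θuA u (X 2)) • boxMonomial k 1 := by
  apply Subtype.ext
  simp only [Subalgebra.coe_mul, coe_smul_kc3Au, coe_θuA, θu_X_two, coe_boxMonomial, box_four, box_one, box_three, monomial_e, map_one]
  ring

/-- `a³c · a⁵b²c = T₀ T₂ • a²b² − U T₁ T₂ • a³c`. [OURS · bookkeeping] -/
theorem m3_mul_m5 : boxMonomial k 3 * boxMonomial k 5 =
    (θuA u (X 0) * θuA u (X 2)) • boxMonomial k 2 - (algebraMap k _ u * θuA u (X 1) * θuA u (X 2)) • boxMonomial k 3 := by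
  apply Subtype.ext
  simp only [Subalgebra.coe_mul, Subalgebra.coe_sub, coe_smul_kc3Au, coe_θuA, θu_X_zero, θu_X_one, θu_X_two, coe_algebraMap_k, coe_boxMonomial, box_five, box_three, box_two, monomial_e, map_one]
  ring

/-- `abc · abc = T₂ • a²b²`. [OURS · bookkeeping] -/
theorem m4_mul_m4 : boxMonomial k 4 * boxMonomial k 4 =
    (θuA u (X 2)) • boxMonomial k 2 := by
  apply Subtype.ext
  simp only [Subalgebra.coe_mul, coe_smul_kc3Au, coe_θuA, θu_X_two, coe_boxMonomial, box_four, box_two, monomial_e, map_one]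
  ring

/-- `abc · a⁵b²c = T₀ T₁ T₂ • 1 − U T₁ T₂ • abc`. [OURS · bookkeeping] -/
theorem m4_mul_m5 : boxMonomial k 4 * boxMonomial k 5 =
    (θuA u (X 0) * θuA u (X 1) * θuA u (X 2)) • boxMonomial k 0 - (algebraMap k _ u * θuA u (X 1) * θuA u (X 2)) • boxMonomial k 4 := by
  apply Subtype.ext
  simp only [Subalgebra.coe_mul, Subalgebra.coe_sub, coe_smul_kc3Au, coe_θuA, θu_X_zero, θu_X_one, θu_X_two, coe_algebraMap_k, coe_boxMonomial, box_five, box_four, box_zero, monomial_e, map_one]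
  ring


end Table


/-! ## Products in the other order -/

/-- `a²b² · a⁴b`. [OURS · bookkeeping] -/
theorem m2_mul_m1 : boxMonomial k 2 * boxMonomial k 1 =
    (θuA u (X 0) * θuA u (X 1)) • boxMonomial k 0 - (algebraMap k _ u * θuA u (X 1)) • boxMonomial k 4 := by
  rw [mul_comm]; exact m1_mul_m2 u
/-- `a³c · a⁴b`. [OURS · bookkeeping] -/
theorem m3_mul_m1 : boxMonomial k 3 * boxMonomial k 1 =
    (θuA u (X 0)) • boxMonomial k 4 - (algebraMap k _ u * θuA u (X 2)) • boxMonomial k 2 := by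
  rw [mul_comm]; exact m1_mul_m3 u
/-- `a³c · a²b²`. [OURS · bookkeeping] -/
theorem m3_mul_m2 : boxMonomial k 3 * boxMonomial k 2 = boxMonomial k 5 := by
  rw [mul_comm]; exact m2_mul_m3
/-- `abc · a⁴b`. [OURS · bookkeeping] -/
theorem m4_mul_m1 : boxMonomial k 4 * boxMonomial k 1 = boxMonomial k 5 := by
  rw [mul_comm]; exact m1_mul_m4
/-- `abc · a²b²`. [OURS · bookkeeping] -/
theorem m4_mul_m2 : boxMonomial k 4 * boxMonomial k 2 = (θuA u (X 1)) • boxMonomial k 3 := by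
  rw [mul_comm]; exact m2_mul_m4 u
/-- `abc · a³c`. [OURS · bookkeeping] -/
theorem m4_mul_m3 : boxMonomial k 4 * boxMonomial k 3 = (θuA u (X 2)) • boxMonomial k 1 := by
  rw [mul_comm]; exact m3_mul_m4 u

/-! ## `W₀` is generated over `A_u` by `a⁴b, a²b², a³c, abc` -/

/-- `W₀ = A_u[a⁴b, a²b², a³c, abc]`. [OURS · L1 w44b] -/
theorem adjoin_box_eq_top :
    Algebra.adjoin ↥(kc3Au u) ({boxMonomial k 1, boxMonomial k 2, boxMonomial k 3, boxMonomial k 4} :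
      Set ↥(kc3W k)) = ⊤ := by
  classical
  rw [eq_top_iff]
  rintro w -
  obtain ⟨f, rfl⟩ := coordAu_surjective u w
  rw [coordAu_apply]
  refine Subalgebra.sum_mem _ fun i _ => Subalgebra.smul_mem _ ?_ _
  have h1 : boxMonomial k 1 ∈ Algebra.adjoin ↥(kc3Au u)
      ({boxMonomial k 1, boxMonomial k 2, boxMonomial k 3, boxMonomial k 4} : Set ↥(kc3W k)) :=
    Algebra.subset_adjoin (by simp)
  have h4 : boxMonomial k 4 ∈ Algebra.adjoin ↥(kc3Au u)
      ({boxMonomial k 1, boxMonomial k 2, boxMonomial k 3, boxMonomial k 4} : Set ↥(kc3W k)) :=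
    Algebra.subset_adjoin (by simp)
  fin_cases i
  · exact boxMonomial_zero (k := k) ▸ one_mem _
  · exact h1
  · exact Algebra.subset_adjoin (by simp)
  · exact Algebra.subset_adjoin (by simp)
  · exact h4
  · exact (m1_mul_m4 (k := k)) ▸ mul_mem h1 h4

end Summit.ResolutionOfSingularities.ResolutionOfSingularities.Theorems.HomologicalConductor.KC3JacobianFloor

end
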